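import Summits.Ventures.LatticeQCDFlow.Scaling.FlowLadderModeGap
import Summits.Ventures.LatticeQCDFlow.Scaling.ReplicaExchangeModeGapHeating
import Summits.Ventures.LatticeQCDFlow.Scaling.FlowSamplerTauInt

/-!
HONEST FRAMING: exact (Metropolis-corrected) sampling algorithms for lattice gauge theory; figures
of merit are autocorrelation/cost numbers at stated couplings and volumes; no continuum-physics
claim.

# FlowLadderModeGapHeating — THE `q`-FREE MONOTONE-LADDER FLOOR OF `Scaling/ReplicaExchangeModeGapHeating` FOR THE FLOW
# LADDER WITH SECTOR-PRESERVING MAPS: `Gap(ptFlowSampler ½ μ M φ) ≥ μ_0(A_{j₀})²·γ_A·min{δ₂/K², γ₀/(K+1)}/(256(K+1)²)`,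
# `δ₂` THE SECTOR-WISE ACCEPTANCE MASS OF THE MAP-ASSISTED SWAP; AND THE `τ_int` CEILINGS OF BOTH SECTOR-PRESERVING FLOORS FOR
# EVERY OBSERVABLE (lean-2 GEN-21, ours)

Venture-side (OURS).  Cell `lqcd-flow` (pub-lqcd), unit `pub-lqcd-lean-2-g21`, 2026-08-26.  Chapter I, eighth file: the
rotation-path form of the mode-gap floor (`Scaling/ReplicaExchangeModeGapHeating`, R3h: on a MONOTONE sector ladder — every
non-trivial sector only gets rarer towards the cold end, the trivial sector `j₀` absorbs the weight — the cold-end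
suppression factor `q^K` of `Scaling/ReplicaExchangeModeGap` disappears and the ladder enters only through the hot mass
`μ_0(A_{j₀})` and the sector-wise swap acceptance) transferred to `ptFlowSampler ½ μ M φ` with SECTOR-PRESERVING adjacent
maps, exactly as `Scaling/FlowLadderModeGap` transfers R3′: sector weights, within-sector Poincaré constants and the hot
gap are invariant under the sector-preserving level coordinates, and the sector-wise plain-swap overlap of the pulled-back
laws is the sector-wise acceptance mass of the map-assisted swap (`modeOverlap_relabel`).

## What is proved

* **`flowLadderMonotone_spectralGap_ge_levelMaps`**, **`flowLadderMonotone_spectralGap_ge`** — sector-preserving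
  `φ_j`, monotone sector ladder (`μ_{l+1}(A_j) ≤ μ_l(A_j)` for `j ≠ j₀`, `μ_l(A_{j₀}) ≤ μ_{l+1}(A_{j₀})`), within-sector
  Poincaré constant `γ_A`, hot global Poincaré constant `γ₀`, sector-wise acceptance mass `δ₂` of the map-assisted swap:
  `Gap(ptFlowSampler ½ μ M φ) ≥ μ_0(A_{j₀})²·γ_A·min{δ₂/K², γ₀/(K+1)}/(256(K+1)²)` — polynomial in `K`, no cold-end
  suppression factor.
* **`flowLadderMode_tauInt_le`** (the `τ_int` form of `Scaling/FlowLadderModeGap`: hot update irreducible ⇒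
  `τ_int(g) ≤ 96(K+1)²/(p q^K γ_A·min{δ₂/K², γ₀/(K+1)}) − ½` for every non-constant `g`) and
  **`flowLadderMonotone_tauInt_le`** (`τ_int(g) ≤ 256(K+1)²/(μ_0(A_{j₀})²·γ_A·min{δ₂/K², γ₀/(K+1)}) − ½`), through the
  irreducibility and `τ_int` bridge of `Scaling/FlowSamplerTauInt`.

Reading (no numerics implied): with sector-preserving flows between neighbouring couplings the replica-exchange floor on a
monotone sector ladder keeps only three physical inputs — the hot replica's tunnelling (`γ₀`), the within-sector relaxation
(`γ_A`) and the sector-wise transport quality (`δ₂`), weighted by the hot mass of the trivial sector.  NOT CLAIMED: maps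
moving mass between sectors; anything measured.  Literature grade (cell rule): OWN COROLLARY; nothing cited as a fact; no
new bib keys.
-/

noncomputable section

open Finset Function
open Literature.Probability.MarkovChains
open Literature.Probability.MarkovChains.Decomposition

namespace Summit.Ventures.LatticeQCDFlow.Scaling

section ModeGapHeating

variable {S J : Type*} [Fintype S] [DecidableEq S] [Fintype J] [DecidableEq J] {K : ℕ}
  {μ : Fin (K + 1) → S → ℝ} {M : Fin (K + 1) → S → S → ℝ} {mode : S → J}

/-- **THE MONOTONE-LADDER FLOOR IN LEVEL COORDINATES** (sector-preserving `L`, `L_0 = 1`):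
`Gap(ptFlowSampler ½ μ M φ^L) ≥ μ_0(A_{j₀})²·γ_A·min{δ₂/K², γ₀/(K+1)}/(256(K+1)²)`. [ours] -/
theorem flowLadderMonotone_spectralGap_ge_levelMaps [Nontrivial S] (L : Fin (K + 1) → Equiv.Perm S)
    (hL0 : L 0 = Equiv.refl S) (hLmode : ∀ (i : Fin (K + 1)) (u : S), mode (L i u) = mode u)
    (hμ : ∀ k x, 0 < μ k x) (hμ1 : ∀ k, ∑ x, μ k x = 1) (hmode : Function.Surjective mode) (hK : 1 ≤ K)
    (hM : ∀ k, IsRowStochastic (M k)) (hMrev : ∀ k, DetailedBalance (μ k) (M k)) (j₀ : J)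
    (hdec : ∀ j, j ≠ j₀ → ∀ l : Fin K, blockMass (μ l.succ) mode j ≤ blockMass (μ l.castSucc) mode j)
    (hinc : ∀ l : Fin K, blockMass (μ l.castSucc) mode j₀ ≤ blockMass (μ l.succ) mode j₀)
    {δ₂ γ₀ γA : ℝ} (hδ0 : 0 < δ₂) (hδ1 : δ₂ ≤ 1) (hγ₀ : 0 < γ₀) (hγA : 0 < γA) (hγA1 : γA ≤ 1)
    (hδ : ∀ (m : Fin (K + 1) → J) (l : Fin K), m ∘ levelSwap l ≠ m →
      δ₂ * min (blockMass (tensorFun μ) (fun z : Fin (K + 1) → S => mode ∘ z) m)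
          (blockMass (tensorFun μ) (fun z : Fin (K + 1) → S => mode ∘ z) (m ∘ levelSwap l))
        ≤ ∑ y ∈ block (fun z : Fin (K + 1) → S => mode ∘ z) m,
            min (tensorFun μ y) (tensorFun μ (flowSwapAt (fun j : Fin K => (L j.castSucc).trans (L j.succ).symm) l y)))
    (hgap0 : ∀ h : S → ℝ, γ₀ * lawVariance (μ 0) h ≤ dirichletForm (μ 0) (M 0) h)
    (hgapA : ∀ k j, ∀ h : S → ℝ, γA * lawVariance (blockLaw (μ k) mode j) h
      ≤ dirichletForm (blockLaw (μ k) mode j) (restrictionChain (M k) mode) h) :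
    (blockMass (μ 0) mode j₀) ^ 2 * γA * min (δ₂ / K ^ 2) (γ₀ / (K + 1)) / (256 * (K + 1) ^ 2)
      ≤ spectralGap (tensorFun μ) (ptFlowSampler (1 / 2) μ M (fun j : Fin K => (L j.castSucc).trans (L j.succ).symm)) := by
  rw [ptFlowSampler_spectralGap_eq_conj L (1 / 2) μ M]
  have hLmode' : ∀ (i : Fin (K + 1)) (u : S), mode ((L i).symm u) = mode u := fun i u => by
    have h := hLmode i ((L i).symm u); rw [Equiv.apply_symm_apply] at h; exact h.symm
  have hL0u : ∀ u, (L 0).symm u = u := fun u => by rw [hL0]; rfl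
  have hν0 : (fun u => μ 0 ((L 0).symm u)) = μ 0 := funext fun u => by rw [hL0u]
  have hM0 : (fun u v => M 0 ((L 0).symm u) ((L 0).symm v)) = M 0 := funext fun u => funext fun v => by rw [hL0u, hL0u]
  have hbm : ∀ (k : Fin (K + 1)) (j : J), blockMass (fun u => μ k ((L k).symm u)) mode j = blockMass (μ k) mode j :=
    fun k j => blockMass_relabel (L k).symm (hLmode' k) (μ k) j
  have h := ptBareMonotoneHalf_spectralGap_ge_of_hotGap (μ := fun i u => μ i ((L i).symm u))
    (M := fun i u v => M i ((L i).symm u) ((L i).symm v)) (mode := mode) (fun k u => hμ k _)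
    (fun k => by rw [Equiv.sum_comp (L k).symm (μ k)]; exact hμ1 k) hmode hK
    (fun k => ⟨fun u v => (hM k).1 _ _,
      fun u => by simpa using (Equiv.sum_comp (L k).symm (fun v => M k ((L k).symm u) v)).trans ((hM k).2 _)⟩)
    (fun k u v => hMrev k _ _) j₀ (fun j hj l => by rw [hbm, hbm]; exact hdec j hj l) (fun l => by rw [hbm, hbm]; exact hinc l)
    hδ0 hδ1 hγ₀ hγA hγA1
    (fun m l hml => by
      rw [blockMass_tensorFun_relabel L hLmode, blockMass_tensorFun_relabel L hLmode, modeOverlap_relabel L hLmode]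
      exact hδ m l hml)
    (fun h => by
      have e1 : lawVariance (fun u => μ 0 ((L 0).symm u)) h = lawVariance (μ 0) h := by rw [hν0]
      have e2 : dirichletForm (fun u => μ 0 ((L 0).symm u)) (fun u v => M 0 ((L 0).symm u) ((L 0).symm v)) h
          = dirichletForm (μ 0) (M 0) h := by rw [hν0, hM0]
      rw [e1, e2]; exact hgap0 h)
    (fun k j h => blockPoincare_relabel (L k).symm (hLmode' k) j (hgapA k j) h)
  rw [hbm] at h
  exact h

/-- **THE MONOTONE-LADDER FLOOR FOR THE FLOW LADDER WITH SECTOR-PRESERVING MAPS:** adjacent bijections with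
`mode(φ_j u) = mode(u)`; monotone sector weights (non-trivial sectors non-increasing, `j₀` non-decreasing towards the cold
end); within-sector Poincaré constant `γ_A`; hot global Poincaré constant `γ₀`; sector-wise acceptance mass `δ₂` of the
map-assisted swaps (`δ₂·min{π̃(B_m), π̃(B_{m∘σ_l})} ≤ Σ_{y∈B_m} min{π̃(y), π̃(flowSwapAt φ l y)}`); `K ≥ 1`, `|S| ≥ 2`:
`Gap(ptFlowSampler ½ μ M φ) ≥ μ_0(A_{j₀})²·γ_A·min{δ₂/K², γ₀/(K+1)}/(256(K+1)²)`. [ours] -/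
theorem flowLadderMonotone_spectralGap_ge [Nontrivial S] (φ : Fin K → Equiv.Perm S)
    (hφmode : ∀ (j : Fin K) (u : S), mode (φ j u) = mode u)
    (hμ : ∀ k x, 0 < μ k x) (hμ1 : ∀ k, ∑ x, μ k x = 1) (hmode : Function.Surjective mode) (hK : 1 ≤ K)
    (hM : ∀ k, IsRowStochastic (M k)) (hMrev : ∀ k, DetailedBalance (μ k) (M k)) (j₀ : J)
    (hdec : ∀ j, j ≠ j₀ → ∀ l : Fin K, blockMass (μ l.succ) mode j ≤ blockMass (μ l.castSucc) mode j)
    (hinc : ∀ l : Fin K, blockMass (μ l.castSucc) mode j₀ ≤ blockMass (μ l.succ) mode j₀)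
    {δ₂ γ₀ γA : ℝ} (hδ0 : 0 < δ₂) (hδ1 : δ₂ ≤ 1) (hγ₀ : 0 < γ₀) (hγA : 0 < γA) (hγA1 : γA ≤ 1)
    (hδ : ∀ (m : Fin (K + 1) → J) (l : Fin K), m ∘ levelSwap l ≠ m →
      δ₂ * min (blockMass (tensorFun μ) (fun z : Fin (K + 1) → S => mode ∘ z) m)
          (blockMass (tensorFun μ) (fun z : Fin (K + 1) → S => mode ∘ z) (m ∘ levelSwap l))
        ≤ ∑ y ∈ block (fun z : Fin (K + 1) → S => mode ∘ z) m, min (tensorFun μ y) (tensorFun μ (flowSwapAt φ l y)))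
    (hgap0 : ∀ h : S → ℝ, γ₀ * lawVariance (μ 0) h ≤ dirichletForm (μ 0) (M 0) h)
    (hgapA : ∀ k j, ∀ h : S → ℝ, γA * lawVariance (blockLaw (μ k) mode j) h
      ≤ dirichletForm (blockLaw (μ k) mode j) (restrictionChain (M k) mode) h) :
    (blockMass (μ 0) mode j₀) ^ 2 * γA * min (δ₂ / K ^ 2) (γ₀ / (K + 1)) / (256 * (K + 1) ^ 2)
      ≤ spectralGap (tensorFun μ) (ptFlowSampler (1 / 2) μ M φ) := by
  obtain ⟨L, hL0, hLφ⟩ := exists_levelMaps φ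
  have hφ : φ = fun j : Fin K => (L j.castSucc).trans (L j.succ).symm := (funext hLφ).symm
  have hLmode' := ladderRelabel_mode (mode := mode) L hL0 φ hLφ hφmode
  have hLmode : ∀ (i : Fin (K + 1)) (u : S), mode (L i u) = mode u := fun i u => by
    have h := hLmode' i (L i u); rw [Equiv.symm_apply_apply] at h; exact h.symm
  subst hφ
  exact flowLadderMonotone_spectralGap_ge_levelMaps L hL0 hLmode hμ hμ1 hmode hK hM hMrev j₀ hdec hinc hδ0 hδ1 hγ₀ hγA
    hγA1 hδ hgap0 hgapA

/-! ## `τ_int` of every observable under sector-preserving maps -/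

/-- **LADDER WITH SECTOR-PRESERVING MAPS, EVERY OBSERVABLE** (`t = ½`, hypotheses of
`flowLadderMode_spectralGap_ge`, hot update irreducible):
`τ_int(g) ≤ 96(K+1)²/(p q^K γ_A·min{δ₂/K², γ₀/(K+1)}) − ½`. [ours] -/
theorem flowLadderMode_tauInt_le [Nontrivial S] {J : Type*} [Fintype J] [DecidableEq J] {M : Fin (K + 1) → S → S → ℝ}
    {mode : S → J} (φ : Fin K → Equiv.Perm S) (hφmode : ∀ (j : Fin K) (u : S), mode (φ j u) = mode u)
    (hμ : ∀ k x, 0 < μ k x) (hμ1 : ∀ k, ∑ x, μ k x = 1) (hmode : Function.Surjective mode) (hK : 1 ≤ K)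
    (hM : ∀ k, IsRowStochastic (M k)) (hMrev : ∀ k, DetailedBalance (μ k) (M k)) (hM0 : IsIrreducible (M 0))
    {p q δ₂ γ₀ γA : ℝ} (hp : 0 < p) (hp1 : p ≤ 1) (hq0 : 0 < q) (hq1 : q ≤ 1) (hδ0 : 0 < δ₂) (hδ1 : δ₂ ≤ 1)
    (hγ₀ : 0 < γ₀) (hγA : 0 < γA) (hγA1 : γA ≤ 1)
    (hpers : ∀ (i k : Fin (K + 1)) (j : J), i ≤ k → p * blockMass (μ k) mode j ≤ blockMass (μ i) mode j)
    (hq : ∀ (l : Fin K) (j : J), q * blockMass (μ l.castSucc) mode j ≤ blockMass (μ l.succ) mode j)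
    (hδ : ∀ (m : Fin (K + 1) → J) (l : Fin K), m ∘ levelSwap l ≠ m →
      δ₂ * min (blockMass (tensorFun μ) (fun z : Fin (K + 1) → S => mode ∘ z) m)
          (blockMass (tensorFun μ) (fun z : Fin (K + 1) → S => mode ∘ z) (m ∘ levelSwap l))
        ≤ ∑ y ∈ block (fun z : Fin (K + 1) → S => mode ∘ z) m, min (tensorFun μ y) (tensorFun μ (flowSwapAt φ l y)))
    (hgap0 : ∀ h : S → ℝ, γ₀ * lawVariance (μ 0) h ≤ dirichletForm (μ 0) (M 0) h)
    (hgapA : ∀ k j, ∀ h : S → ℝ, γA * lawVariance (blockLaw (μ k) mode j) h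
      ≤ dirichletForm (blockLaw (μ k) mode j) (restrictionChain (M k) mode) h)
    {g : (Fin (K + 1) → S) → ℝ} (hg : 0 < lawVariance (tensorFun μ) g) :
    asympVar g (tensorFun μ) (ptFlowSampler (1 / 2) μ M φ) / (2 * lawVariance (tensorFun μ) g)
      ≤ 96 * (K + 1) ^ 2 / (p * q ^ K * γA * min (δ₂ / K ^ 2) (γ₀ / (K + 1))) - 1 / 2 := by
  have ht0 : (0 : ℝ) < 1 / 2 := by norm_num
  have ht1 : (1 / 2 : ℝ) < 1 := by norm_num
  have hKr : (1 : ℝ) ≤ K := by exact_mod_cast hK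
  have hm : 0 < min (δ₂ / K ^ 2) (γ₀ / (K + 1)) := lt_min (div_pos hδ0 (by positivity)) (div_pos hγ₀ (by positivity))
  have hc0 : 0 < p * q ^ K * γA * min (δ₂ / K ^ 2) (γ₀ / (K + 1)) / (96 * (K + 1) ^ 2) := by positivity
  have h := tauInt_le_of_gapFloor (tensorFun_pos hμ) (sum_tensorFun_eq_one μ hμ1)
    (ptFlowSampler_isRowStochastic hμ hM ht0.le ht1.le) (ptFlowSampler_detailedBalance hμ hMrev)
    (ptFlowSampler_isIrreducible_of_hot φ hμ hM hM0 ht0 ht1) hc0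
    (flowLadderMode_spectralGap_ge φ hφmode hμ hμ1 hmode hK hM hMrev hp hp1 hq0 hq1 hδ0 hδ1 hγ₀ hγA hγA1 hpers hq hδ
      hgap0 hgapA) hg
  have e : 1 / (p * q ^ K * γA * min (δ₂ / K ^ 2) (γ₀ / (K + 1)) / (96 * (K + 1) ^ 2))
      = 96 * (K + 1) ^ 2 / (p * q ^ K * γA * min (δ₂ / K ^ 2) (γ₀ / (K + 1))) := by
    rw [one_div, inv_div]
  rw [e] at h
  exact h

/-- **MONOTONE LADDER WITH SECTOR-PRESERVING MAPS, EVERY OBSERVABLE** (`t = ½`, hypotheses of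
`flowLadderMonotone_spectralGap_ge`, hot update irreducible):
`τ_int(g) ≤ 256(K+1)²/(μ_0(A_{j₀})²·γ_A·min{δ₂/K², γ₀/(K+1)}) − ½`. [ours] -/
theorem flowLadderMonotone_tauInt_le [Nontrivial S] (φ : Fin K → Equiv.Perm S)
    (hφmode : ∀ (j : Fin K) (u : S), mode (φ j u) = mode u)
    (hμ : ∀ k x, 0 < μ k x) (hμ1 : ∀ k, ∑ x, μ k x = 1) (hmode : Function.Surjective mode) (hK : 1 ≤ K)
    (hM : ∀ k, IsRowStochastic (M k)) (hMrev : ∀ k, DetailedBalance (μ k) (M k)) (hM0 : IsIrreducible (M 0)) (j₀ : J)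
    (hdec : ∀ j, j ≠ j₀ → ∀ l : Fin K, blockMass (μ l.succ) mode j ≤ blockMass (μ l.castSucc) mode j)
    (hinc : ∀ l : Fin K, blockMass (μ l.castSucc) mode j₀ ≤ blockMass (μ l.succ) mode j₀)
    {δ₂ γ₀ γA : ℝ} (hδ0 : 0 < δ₂) (hδ1 : δ₂ ≤ 1) (hγ₀ : 0 < γ₀) (hγA : 0 < γA) (hγA1 : γA ≤ 1)
    (hδ : ∀ (m : Fin (K + 1) → J) (l : Fin K), m ∘ levelSwap l ≠ m →
      δ₂ * min (blockMass (tensorFun μ) (fun z : Fin (K + 1) → S => mode ∘ z) m)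
          (blockMass (tensorFun μ) (fun z : Fin (K + 1) → S => mode ∘ z) (m ∘ levelSwap l))
        ≤ ∑ y ∈ block (fun z : Fin (K + 1) → S => mode ∘ z) m, min (tensorFun μ y) (tensorFun μ (flowSwapAt φ l y)))
    (hgap0 : ∀ h : S → ℝ, γ₀ * lawVariance (μ 0) h ≤ dirichletForm (μ 0) (M 0) h)
    (hgapA : ∀ k j, ∀ h : S → ℝ, γA * lawVariance (blockLaw (μ k) mode j) h
      ≤ dirichletForm (blockLaw (μ k) mode j) (restrictionChain (M k) mode) h)
    {g : (Fin (K + 1) → S) → ℝ} (hg : 0 < lawVariance (tensorFun μ) g) :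
    asympVar g (tensorFun μ) (ptFlowSampler (1 / 2) μ M φ) / (2 * lawVariance (tensorFun μ) g)
      ≤ 256 * (K + 1) ^ 2 / ((blockMass (μ 0) mode j₀) ^ 2 * γA * min (δ₂ / K ^ 2) (γ₀ / (K + 1))) - 1 / 2 := by
  have ht0 : (0 : ℝ) < 1 / 2 := by norm_num
  have ht1 : (1 / 2 : ℝ) < 1 := by norm_num
  have hKr : (1 : ℝ) ≤ K := by exact_mod_cast hK
  have hb : 0 < blockMass (μ 0) mode j₀ := blockMass_pos (hμ 0) hmode j₀
  have hm : 0 < min (δ₂ / K ^ 2) (γ₀ / (K + 1)) := lt_min (div_pos hδ0 (by positivity)) (div_pos hγ₀ (by positivity))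
  have hc0 : 0 < (blockMass (μ 0) mode j₀) ^ 2 * γA * min (δ₂ / K ^ 2) (γ₀ / (K + 1)) / (256 * (K + 1) ^ 2) := by
    positivity
  have h := tauInt_le_of_gapFloor (tensorFun_pos hμ) (sum_tensorFun_eq_one μ hμ1)
    (ptFlowSampler_isRowStochastic hμ hM ht0.le ht1.le) (ptFlowSampler_detailedBalance hμ hMrev)
    (ptFlowSampler_isIrreducible_of_hot φ hμ hM hM0 ht0 ht1) hc0
    (flowLadderMonotone_spectralGap_ge φ hφmode hμ hμ1 hmode hK hM hMrev j₀ hdec hinc hδ0 hδ1 hγ₀ hγA hγA1 hδ hgap0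
      hgapA) hg
  have e : 1 / ((blockMass (μ 0) mode j₀) ^ 2 * γA * min (δ₂ / K ^ 2) (γ₀ / (K + 1)) / (256 * (K + 1) ^ 2))
      = 256 * (K + 1) ^ 2 / ((blockMass (μ 0) mode j₀) ^ 2 * γA * min (δ₂ / K ^ 2) (γ₀ / (K + 1))) := by
    rw [one_div, inv_div]
  rw [e] at h
  exact h

end ModeGapHeating

end Summit.Ventures.LatticeQCDFlow.Scaling

end
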